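import Literature.NumberTheory.EllipticCurves.LocalKummerIsotropyTransport
import Literature.NumberTheory.EllipticCurves.PointDivisibilityProofs
import Literature.NumberTheory.EllipticCurves.LocalPointsIntegersSubgroup
import HarnessLib

/-!
# The local Kummer map on `K_v`-points and the order of the local Kummer condition

Topic `NumberTheory/EllipticCurves`; namespace `WeierstrassCurve`. Definitions with bodies and theorems
only: **no named fact is introduced** (D-0026).

For an elliptic curve `E = W` over a field `K` of characteristic `0`, a `K`-field `E` (a completion
`K_v`) and `n ≠ 0`, the tree's local Kummer condition
`𝓛_E = kummerLocalConditionAt W n E ≤ H¹(Γ_E, E[n](K̄)|_{Γ_E})` (`KummerSelmerStructure.lean`) is the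
image of the local Kummer map `E(E)/nE(E) → H¹(E, E[n])` (Silverman, *AEC*, X.§4, the exact rows
`0 → E(K_v)/mE(K_v) → H¹(G_v, E[m]) → H¹(G_v, E)[m] → 0` of diagram (**) before Thm. X.4.2; Milne,
*ADT*, I.§6, diagram in the proof of Lemma 6.15 / (6.14)).  There the group `E(E)` is the group of
`Γ_E`-fixed points of `E(K̄_E) = localPoints W E`.  This file realises the local Kummer map on
**Mathlib's group of `E`-rational points** `(W.baseChange E).toAffine.Point` — the group on which the
structure of `E(K_v)` is known (`LocalPointsIntegersSubgroup.lean`: Silverman VII.6.3 / Milne I.3.3) —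
and computes the order of `𝓛_{K_v}` at a finite place of a number field:

* `torsionLocalIso W E hn : (W⁄E)[n](Ē) ≅ E[n](K̄)|_{Γ_E}` — the torsion transfer of
  `LocalKummerIsotropyTransport.lean` (`torsionTransferInvHom`) as an isomorphism of discrete
  `Γ_E`-modules, whence `H¹(E, (W⁄E)[n]) ≃ H¹(Γ_E, E[n](K̄)|_{Γ_E})`
  (tree `continuousCohomologyEquivOfIso`);
* `localKummerMap W E hn : (W⁄E)(E) →+ H¹(Γ_E, E[n](K̄)|_{Γ_E})`, the Kummer map of the base-changed
  curve (tree `kummerMapTorsion`, fed by the divisibility `zsmul_geomPoints_surjective_holds` of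
  `(W⁄E)(Ē)`) followed by that isomorphism; `localKummerMap_eq_localKummerClass`: its value at `P` is
  the local Kummer class `κ_E(Q)` (`localKummerClass`) of any `Q ∈ E(K̄_E)` with `nQ = P`;
* **exactness of the local Kummer sequence on `E`-points**: `range_localKummerMap`
  (`im = 𝓛_E`, Silverman X.§4 (**)) and `ker_localKummerMap` (`ker = n·(W⁄E)(E)`, Silverman VIII.§2),
  packaged as `quotientRangeZSMulEquivKummerLocalConditionAt : (W⁄E)(E)/n ≃+ 𝓛_E` and
  `natCard_kummerLocalConditionAt_eq_index : #𝓛_E = [(W⁄E)(E) : n(W⁄E)(E)]`;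
* over a number field `K`, at a finite place `v` (`E = K_v = v.adicCompletion K`):
  **`#𝓛_{K_v} = #E(K_v)[n] · #(𝓞_v/n𝓞_v)`** (`natCard_kummerLocalConditionAt_adicCompletion`, from
  `card_quotient_range_nsmul_adicCompletion`, Milne I Lemma 3.3 / Silverman VII.6.3) and the
  finiteness of `𝓛_{K_v}` (`finite_kummerLocalConditionAt_adicCompletion`); the same at the place
  `Sum.inr v` of the Kummer Selmer structure (`natCard_kummerSelmerStructure_inr`).

This is the `E`-side order input of Tate local duality for `E` (Milne, *ADT*, I Thm. 3.2 / Cor. 3.4,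
`H¹(K_v, E)[n] ≅ (E(K_v)/n)^*`) and of the maximality `𝓛_v^⊥ = 𝓛_v` of the local Kummer images
(Milne I Lemma 6.15), for the provefact unit `WeierstrassCurve.exists_casselsTate_pairing`.

## References

* [SilvermanAEC2009] J. H. Silverman, *The Arithmetic of Elliptic Curves*, 2nd ed. (2009), VIII.§2
  (the Kummer sequence, pp. 190–191), X.§4 (diagram (**) before Thm. X.4.2, p. 331),
  Prop. VII.6.3.
* [MilneADT2006] J. S. Milne, *Arithmetic Duality Theorems*, 2nd ed. (2006), Ch. I, Lemma 3.3,
  Cor. 3.4, §6 (proof of Prop. 6.9; Lemma 6.15).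
-/

noncomputable section

open scoped Classical

universe u

namespace WeierstrassCurve

open CategoryTheory Literature.NumberTheory.EllipticCurves Literature.NumberTheory.GaloisRepresentations
  Field

section General

variable {K : Type u} [Field K] (W : WeierstrassCurve K) [W.IsElliptic]
variable (E : Type u) [Field E] [Algebra K E] {n : ℤ}

/-- `(W⁄E)(Ē)` is `n`-divisible for `n ≠ 0` (tree `zsmul_geomPoints_surjective_holds` for the
elliptic curve `W⁄E`). Silverman, *AEC*, VIII.§2 with III.4.2(a). [folklore] -/
theorem exists_zsmul_eq_geomPoints_baseChange (hn : n ≠ 0) (P : geomPoints (W.baseChange E)) :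
    ∃ Q : geomPoints (W.baseChange E), n • Q = P :=
  (W.baseChange E).zsmul_geomPoints_surjective_holds hn P

omit [W.IsElliptic] in
/-- If `n • Q = e(P)` in `E(K̄_E)` for an `E`-rational point `P` (`e = baseChangeGeomPointsEquiv`,
`P` embedded by `toGeomPoints`), then `n • Q` is `Γ_E`-fixed. [folklore] -/
theorem zsmul_mem_fixedPoints_of_eq {P : (W.baseChange E).toAffine.Point} {Q : localPoints W E}
    (hQ : n • Q = W.baseChangeGeomPointsEquiv E (toGeomPoints (W.baseChange E) P)) :
    n • Q ∈ MulAction.fixedPoints (absoluteGaloisGroup E) (localPoints W E) := fun σ => by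
  rw [hQ, ← baseChangeGeomPointsEquiv_smul, smul_toGeomPoints]

/-- A chosen `n`-th root in `E(K̄_E)` of (the image of) an `E`-rational point `P` ("choose
`Q ∈ E(K̄_v)` with `[n]Q = P`"), from the divisibility of `(W⁄E)(Ē)`. Silverman, *AEC*, VIII.§2.
[folklore] -/
def localZSMulRoot (hn : n ≠ 0) (P : (W.baseChange E).toAffine.Point) : localPoints W E :=
  W.baseChangeGeomPointsEquiv E
    (Classical.choose (W.exists_zsmul_eq_geomPoints_baseChange E hn (toGeomPoints (W.baseChange E) P)))

/-- `n • localZSMulRoot P = e(P)`. [folklore] -/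
theorem zsmul_localZSMulRoot (hn : n ≠ 0) (P : (W.baseChange E).toAffine.Point) :
    n • W.localZSMulRoot E hn P = W.baseChangeGeomPointsEquiv E (toGeomPoints (W.baseChange E) P) := by
  rw [localZSMulRoot, ← map_zsmul,
    Classical.choose_spec (W.exists_zsmul_eq_geomPoints_baseChange E hn (toGeomPoints (W.baseChange E) P))]

variable [CharZero K]

/-- **`(W⁄E)[n](Ē) ≅ E[n](K̄)|_{Γ_E}` as discrete `Γ_E`-modules**: the inverse torsion transfer
`torsionTransferEquiv⁻¹` of `LocalKummerIsotropyTransport.lean` (equivariant by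
`torsionTransferEquiv_symm_smul`) as an isomorphism of topological representations
(tree constructor `topRepIsoOfEquiv`); its `hom` is `torsionTransferInvHom`. [folklore] -/
def torsionLocalIso (hn : n ≠ 0) :
    ((W.baseChange E).torsionGaloisModule n).toTopRep ≅
      DiscreteGaloisModule.toTopRep (GaloisRep.restrictField E (W.torsionGaloisModule n)) :=
  topRepIsoOfEquiv (X := ((W.baseChange E).torsionGaloisModule n).toTopRep)
    (Y := DiscreteGaloisModule.toTopRep (GaloisRep.restrictField E (W.torsionGaloisModule n)))
    { (W.torsionTransferEquiv (E := E) hn).symm.toIntLinearEquiv with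
      continuous_toFun := continuous_of_discreteTopology
      continuous_invFun := continuous_of_discreteTopology }
    fun σ S => W.torsionTransferEquiv_symm_smul (E := E) hn σ S

/-- The `hom` of `torsionLocalIso` is the tree's `torsionTransferInvHom`. [folklore] -/
theorem torsionLocalIso_hom (hn : n ≠ 0) :
    (W.torsionLocalIso E hn).hom = W.torsionTransferInvHom (E := E) hn :=
  rfl

/-- **`H¹(E, (W⁄E)[n]) ≃ H¹(Γ_E, E[n](K̄)|_{Γ_E})`**, induced by `torsionLocalIso`
(tree `continuousCohomologyEquivOfIso`). [folklore] -/
def galH1TorsionBaseChangeEquiv (hn : n ≠ 0) :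
    galH1Torsion (W.baseChange E) n ≃
      galoisCohomology (GaloisRep.restrictField E (W.torsionGaloisModule n)) 1 :=
  continuousCohomologyEquivOfIso (W.torsionLocalIso E hn) 1

/-- Unfolding `galH1TorsionBaseChangeEquiv`: it is `H¹(torsionTransferInvHom)`. [folklore] -/
theorem galH1TorsionBaseChangeEquiv_apply (hn : n ≠ 0) (c : galH1Torsion (W.baseChange E) n) :
    W.galH1TorsionBaseChangeEquiv E hn c = cohomologyMap (W.torsionTransferInvHom (E := E) hn) 1 c :=
  rfl

/-- **The local Kummer map on `E`-rational points** `(W⁄E)(E) →+ H¹(Γ_E, E[n](K̄)|_{Γ_E})`,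
`P ↦ κ_E(Q) = [σ ↦ σQ - Q]` for any `Q ∈ E(K̄_E)` with `nQ = P` (tree `localKummerClass`; a root
exists by the divisibility of `(W⁄E)(Ē)`, and the class does not depend on it,
`localKummerClass_eq_of_zsmul_eq`; additive by `localKummerClass_add`). Silverman, *AEC*, VIII.§2
and X.§4 (the local Kummer maps `E(K_v)/mE(K_v) → H¹(G_v, E[m])` of diagram (**)); Milne, *ADT*,
I.§6. [cite: SilvermanAEC2009, X.§4 diagram (**)] -/
def localKummerMap (hn : n ≠ 0) :
    (W.baseChange E).toAffine.Point →+
      galoisCohomology (GaloisRep.restrictField E (W.torsionGaloisModule n)) 1 :=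
  AddMonoidHom.mk'
    (fun P => W.localKummerClass n hn (W.localZSMulRoot E hn P)
      (W.zsmul_mem_fixedPoints_of_eq E (W.zsmul_localZSMulRoot E hn P)))
    fun P P' => by
      have h : n • (W.localZSMulRoot E hn P + W.localZSMulRoot E hn P') =
          W.baseChangeGeomPointsEquiv E (toGeomPoints (W.baseChange E) (P + P')) := by
        rw [zsmul_add, zsmul_localZSMulRoot, zsmul_localZSMulRoot, map_add, map_add]
      change W.localKummerClass n hn (W.localZSMulRoot E hn (P + P')) _ =
        W.localKummerClass n hn (W.localZSMulRoot E hn P) _ +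
          W.localKummerClass n hn (W.localZSMulRoot E hn P') _
      rw [W.localKummerClass_eq_of_zsmul_eq n hn (W.localZSMulRoot E hn (P + P'))
        (W.localZSMulRoot E hn P + W.localZSMulRoot E hn P') _ (W.zsmul_mem_fixedPoints_of_eq E h)
        (by rw [zsmul_localZSMulRoot, h])]
      exact W.localKummerClass_add n hn _ _ _ _ _

/-- **The local Kummer map computes local Kummer classes**: for `P ∈ (W⁄E)(E)` and ANY
`Q ∈ E(K̄_E)` with `n • Q = P` (read in `E(K̄_E)` through `e = baseChangeGeomPointsEquiv`),
`localKummerMap P = κ_E(Q)`. Silverman, *AEC*, VIII.§2 (`δ(P)(σ) = Q^σ - Q` is independent of the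
choice of `Q`). [folklore] -/
theorem localKummerMap_eq_localKummerClass (hn : n ≠ 0) (P : (W.baseChange E).toAffine.Point)
    (Q : localPoints W E)
    (hQfix : n • Q ∈ MulAction.fixedPoints (absoluteGaloisGroup E) (localPoints W E))
    (hQ : n • Q = W.baseChangeGeomPointsEquiv E (toGeomPoints (W.baseChange E) P)) :
    W.localKummerMap E hn P = W.localKummerClass n hn Q hQfix :=
  W.localKummerClass_eq_of_zsmul_eq n hn _ _ _ _ (by rw [zsmul_localZSMulRoot, hQ])

/-- **Compatibility with the Kummer map of the base-changed curve**: `localKummerMap` is the Kummer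
map `kummerMapTorsion` of `W⁄E` (for any admissible choice of roots `hdiv`) followed by
`H¹(torsionTransferInvHom) : H¹(E, (W⁄E)[n]) → H¹(Γ_E, E[n](K̄)|_{Γ_E})`
(tree `cohomologyMap_torsionTransferInvHom_kummerClassTorsion`). [folklore] -/
theorem localKummerMap_eq_cohomologyMap_kummerMapTorsion (hn : n ≠ 0)
    (hdiv : ∀ P : geomPoints (W.baseChange E), ∃ Q : geomPoints (W.baseChange E), n • Q = P)
    (P : (W.baseChange E).toAffine.Point) :
    W.localKummerMap E hn P =
      cohomologyMap (W.torsionTransferInvHom (E := E) hn) 1 (kummerMapTorsion (W.baseChange E) n hdiv P) := by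
  obtain ⟨Q', hQ'⟩ := hdiv (toGeomPoints (W.baseChange E) P)
  rw [kummerMapTorsion_apply, kummerMapTorsionFun_eq (W.baseChange E) n hdiv P Q' hQ',
    cohomologyMap_torsionTransferInvHom_kummerClassTorsion]
  exact W.localKummerMap_eq_localKummerClass E hn P _ _ (by rw [← map_zsmul, hQ'])

/-- The local Kummer map lands in the local Kummer condition `𝓛_E`. Silverman, *AEC*, X.§4
(commutativity of (**)). [folklore] -/
theorem localKummerMap_mem (hn : n ≠ 0) (P : (W.baseChange E).toAffine.Point) :
    W.localKummerMap E hn P ∈ W.kummerLocalConditionAt n E :=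
  W.localKummerClass_mem_kummerLocalConditionAt n hn _ _

/-- **Exactness of the local Kummer sequence at `H¹(E, E[n])`, on `E`-rational points**: the image
of `localKummerMap` is the local Kummer condition `𝓛_E = ker (H¹(Γ_E, E[n]) → H¹(Γ_E, E(K̄_E)))`
(tree `exists_eq_localKummerClass_of_mem` and Galois descent `E(K̄_E)^{Γ_E} = (W⁄E)(E)`,
`mem_range_toGeomPoints_iff`, `E` being perfect). Silverman, *AEC*, X.§4 (exact rows of (**));
Milne, *ADT*, I.§6 (6.14). [cite: SilvermanAEC2009, X.§4 diagram (**)] -/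
theorem range_localKummerMap [CharZero E] (hn : n ≠ 0) :
    (W.localKummerMap E hn).range = W.kummerLocalConditionAt n E := by
  refine le_antisymm ?_ fun c hc => ?_
  · rintro c ⟨P, rfl⟩
    exact W.localKummerMap_mem E hn P
  · obtain ⟨Q, hQfix, rfl⟩ := W.exists_eq_localKummerClass_of_mem n hn hc
    have hfix' : (W.baseChangeGeomPointsEquiv E).symm (n • Q) ∈
        MulAction.fixedPoints (absoluteGaloisGroup E) (geomPoints (W.baseChange E)) := fun σ => by
      rw [← baseChangeGeomPointsEquiv_symm_smul, hQfix σ]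
    obtain ⟨P, hP⟩ := (mem_range_toGeomPoints_iff (W.baseChange E) _).mpr hfix'
    refine ⟨P, W.localKummerMap_eq_localKummerClass E hn P Q hQfix ?_⟩
    rw [hP, AddEquiv.apply_symm_apply]

/-- **Exactness of the local Kummer sequence at `E(E)/nE(E)`, on `E`-rational points**: the kernel
of `localKummerMap` is `n · (W⁄E)(E)` (`κ_E(Q) = 0` iff `Q` is `Γ_E`-fixed up to an `n`-torsion point,
`localKummerClass_eq_zero_iff`, and Galois descent `E(K̄_E)^{Γ_E} = (W⁄E)(E)`). Silverman, *AEC*,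
VIII.§2 (exactness of the Kummer sequence at `E(K)/mE(K)`). [folklore] -/
theorem ker_localKummerMap [CharZero E] (hn : n ≠ 0) :
    (W.localKummerMap E hn).ker =
      (zsmulAddGroupHom n : (W.baseChange E).toAffine.Point →+ _).range := by
  ext P
  rw [AddMonoidHom.mem_ker, AddMonoidHom.mem_range]
  change W.localKummerClass n hn (W.localZSMulRoot E hn P) _ = 0 ↔ _
  rw [localKummerClass_eq_zero_iff]
  constructor
  · rintro ⟨T, hT, hfix⟩
    have hfix' : (W.baseChangeGeomPointsEquiv E).symm (W.localZSMulRoot E hn P - T) ∈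
        MulAction.fixedPoints (absoluteGaloisGroup E) (geomPoints (W.baseChange E)) := fun σ => by
      rw [← baseChangeGeomPointsEquiv_symm_smul, hfix σ]
    obtain ⟨R, hR⟩ := (mem_range_toGeomPoints_iff (W.baseChange E) _).mpr hfix'
    refine ⟨R, toGeomPoints_injective (W.baseChange E) ?_⟩
    apply (W.baseChangeGeomPointsEquiv E).injective
    rw [zsmulAddGroupHom_apply, map_zsmul, hR, map_zsmul, AddEquiv.apply_symm_apply, zsmul_sub,
      zsmul_localZSMulRoot, (Submodule.mem_torsionBy_iff n T).mp hT, sub_zero]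
  · rintro ⟨R, rfl⟩
    refine ⟨W.localZSMulRoot E hn (zsmulAddGroupHom n R) -
        W.baseChangeGeomPointsEquiv E (toGeomPoints (W.baseChange E) R), ?_, ?_⟩
    · rw [AddSubgroup.torsionBy, Submodule.mem_toAddSubgroup, Submodule.mem_torsionBy_iff]
      change n • (W.localZSMulRoot E hn (zsmulAddGroupHom n R) -
        W.baseChangeGeomPointsEquiv E (toGeomPoints (W.baseChange E) R)) = 0
      rw [zsmul_sub, zsmul_localZSMulRoot, zsmulAddGroupHom_apply, map_zsmul, map_zsmul, sub_self]
    · rw [sub_sub_cancel]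
      exact fun σ => by rw [← baseChangeGeomPointsEquiv_smul, smul_toGeomPoints]

/-- **`(W⁄E)(E)/n ≃+ 𝓛_E`**: the local Kummer map induces an isomorphism of `E(E)/nE(E)` (Mathlib's
`E`-rational points of `W⁄E` modulo `n`) onto the local Kummer condition (first isomorphism theorem
with `ker_localKummerMap`, `range_localKummerMap`). Silverman, *AEC*, X.§4 (**); Milne, *ADT*, I.§6.
[folklore] -/
def quotientRangeZSMulEquivKummerLocalConditionAt [CharZero E] (hn : n ≠ 0) :
    (W.baseChange E).toAffine.Point ⧸
        (zsmulAddGroupHom n : (W.baseChange E).toAffine.Point →+ _).range ≃+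
      W.kummerLocalConditionAt n E :=
  ((QuotientAddGroup.quotientAddEquivOfEq (W.ker_localKummerMap E hn)).symm.trans
    (QuotientAddGroup.quotientKerEquivRange (W.localKummerMap E hn))).trans
    (AddEquiv.addSubgroupCongr (W.range_localKummerMap E hn))

/-- **`#𝓛_E = [(W⁄E)(E) : n(W⁄E)(E)]`** (both sides `0` when infinite). Milne, *ADT*, I.§6, proof of
Lemma 6.15 (the image of `∏ H⁰(K_v, A) → ∏ H¹(K_v, A_m)`); Silverman, *AEC*, X.§4. [folklore] -/
theorem natCard_kummerLocalConditionAt_eq_index [CharZero E] (hn : n ≠ 0) :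
    Nat.card (W.kummerLocalConditionAt n E) =
      (zsmulAddGroupHom n : (W.baseChange E).toAffine.Point →+ _).range.index := by
  rw [AddSubgroup.index, Nat.card_congr (W.quotientRangeZSMulEquivKummerLocalConditionAt E hn).toEquiv]

end General

/-! ## Over a number field: the order of `𝓛_{K_v}` at a finite place -/

section NumberField

open NumberField IsDedekindDomain

variable {K : Type u} [Field K] [NumberField K] (W : WeierstrassCurve K) [W.IsElliptic]
variable (v : HeightOneSpectrum (𝓞 K)) {n : ℕ}

/-- Multiplication by the integer `↑n` is multiplication by the natural number `n`. [folklore] -/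
theorem zsmulAddGroupHom_natCast (A : Type*) [AddCommGroup A] (n : ℕ) :
    (zsmulAddGroupHom (n : ℤ) : A →+ A) = nsmulAddMonoidHom n :=
  AddMonoidHom.ext fun a => natCast_zsmul a n

/-- **The order of the local Kummer condition at a finite place**:
`#𝓛_{K_v} = #E(K_v)[n] · #(𝓞_v / n𝓞_v)` for `n ≠ 0`, where `E(K_v)` is Mathlib's group of
`K_v`-points of `W⁄K_v` (`K_v = v.adicCompletion K`) — the local Kummer sequence
(`natCard_kummerLocalConditionAt_eq_index`) and the structure of `E(K_v)`
(`card_quotient_range_nsmul_adicCompletion`: Silverman VII.6.3 / Milne I Lemma 3.3).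
Milne, *ADT*, I Lemma 3.3 with Cor. 3.4 and §6 (proof of Lemma 6.15).
[cite: MilneADT2006, I Lemma 3.3] [cite: SilvermanAEC2009, X.§4 diagram (**)] -/
theorem natCard_kummerLocalConditionAt_adicCompletion (hn : n ≠ 0) :
    Nat.card (W.kummerLocalConditionAt (n : ℤ) (v.adicCompletion K)) =
      Nat.card (nsmulAddMonoidHom n :
          (W.baseChange (v.adicCompletion K)).toAffine.Point →+ _).ker *
        Nat.card (v.adicCompletionIntegers K ⧸
          Ideal.span {(n : v.adicCompletionIntegers K)}) := by
  haveI : CharZero (v.adicCompletion K) := charZero_adicCompletion v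
  rw [W.natCard_kummerLocalConditionAt_eq_index (v.adicCompletion K) (Int.natCast_ne_zero.mpr hn),
    zsmulAddGroupHom_natCast, AddSubgroup.index, W.card_quotient_range_nsmul_adicCompletion v hn]

/-- **`𝓛_{K_v}` is finite** at a finite place (`n ≠ 0`). Milne, *ADT*, I Lemma 3.3 / §6.
[cite: MilneADT2006, I Lemma 3.3] -/
theorem finite_kummerLocalConditionAt_adicCompletion (hn : n ≠ 0) :
    Finite (W.kummerLocalConditionAt (n : ℤ) (v.adicCompletion K)) := by
  haveI := W.finite_ker_nsmul_adicCompletion v hn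
  refine Nat.finite_of_card_ne_zero ?_
  rw [W.natCard_kummerLocalConditionAt_adicCompletion v hn]
  exact mul_ne_zero Nat.card_pos.ne' (LocalPoints.card_quotient_span_natCast_ne_zero v hn)

/-- The order of the local condition of the Kummer Selmer structure at the finite place `Sum.inr v`
(`Place.Completion (Sum.inr v) = v.adicCompletion K` definitionally):
`#𝓛_v = #E(K_v)[n] · #(𝓞_v / n𝓞_v)`. Milne, *ADT*, I Lemma 3.3, §6. [cite: MilneADT2006, I Lemma 3.3] -/
theorem natCard_kummerSelmerStructure_inr (hn : n ≠ 0) :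
    Nat.card (W.kummerSelmerStructure (n : ℤ) (Sum.inr v)) =
      Nat.card (nsmulAddMonoidHom n :
          (W.baseChange (v.adicCompletion K)).toAffine.Point →+ _).ker *
        Nat.card (v.adicCompletionIntegers K ⧸
          Ideal.span {(n : v.adicCompletionIntegers K)}) :=
  W.natCard_kummerLocalConditionAt_adicCompletion v hn

/-- The local condition of the Kummer Selmer structure at a finite place is finite (`n ≠ 0`).
Milne, *ADT*, I Lemma 3.3, §6. [cite: MilneADT2006, I Lemma 3.3] -/
theorem finite_kummerSelmerStructure_inr (hn : n ≠ 0) :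
    Finite (W.kummerSelmerStructure (n : ℤ) (Sum.inr v)) :=
  W.finite_kummerLocalConditionAt_adicCompletion v hn

end NumberField

end WeierstrassCurve

end
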